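import Summits.CriticalPhenomena.PercolationContinuityZ3.Theorems.PercLowPointHalfSpaceTallClusterMassBoundArrowOneThreshold
import Summits.CriticalPhenomena.PercolationContinuityZ3.Theorems.PercLowPointHalfSpaceTallClusterMassBoundWallArmPartial
import Summits.CriticalPhenomena.PercolationContinuityZ3.Theorems.PercLowPointHalfSpaceLowPointBookkeepingStubDilutionToolkit
import Literature.Probability.Percolation.UniquenessInfiniteCluster

/-!
# `TallClusterMassBound` (stmt-CriticalPhenomena-0912), line `onesided-halves` — stub G, first step of the merging attempt:
# lateral translation invariance of the induced half-space percolation and of Hutchcroft's typical maximum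

The merging route to stub G (`stub_typicalMaxPolyGrowth`) starts from: the big half-box `Λ_{Lr}` contains `≍ L²` disjoint
LATERAL translates `Λ_r + z` (`z₀ = 0`) of `Λ_r = halfBox r`, and each of them carries, with `P^ℍ`-probability `≥ 1 - 8ε`,
an open cluster with at least `ε M(Λ_r)` vertices in it. This file proves that first step, sorry-free, for the
floor-diluted half-space measures `P^ℍ_{p,s} = floorDilutedPercolation 3 p s` (all `p, s`; `s = 1` is the induced
half-space percolation of the line):

* §1 transport of cluster traces under a relabelling `e : V ≃ W` of the vertices (`reachable_relabel_iff` of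
  `UniquenessInfiniteCluster.lean`): `clusterCapIn (Λ.image e) (e·ω) (e v) = clusterCapIn Λ ω v`,
  `clusterMaxIn (Λ.image e) (e·ω) = clusterMaxIn Λ ω`;
* §2 lateral shifts `z` (`z₀ = 0`) preserve the weights `floorDilutedParam 3 p s`
  (`FloorRusso.DilutionToolkit.floorDilutedParam_shift`, in the tree), hence the measure for EVERY `p, s`:
  `(P^ℍ_{p,s}).map (ω ↦ ω + z) = P^ℍ_{p,s}` (`DilutionToolkit.map_shift` is the case `p = p_c`);
* §3 consequences: `P^ℍ(|K_max(Λ + z)| ≥ n) = P^ℍ(|K_max(Λ)| ≥ n)`, the registered helper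
  `typicalMax_translate_lateral : M(Λ + z) = M(Λ)`, and with Hutchcroft's two-sided tightness
  `P^ℍ(|K_max(Λ + z)| < ε M(Λ)) ≤ 8ε` (`real_clusterMaxIn_translate_lt_le`).

The NEXT step — that the clusters of adjacent translates merge into one cluster of `Λ_{Lr}` with probability bounded
below — has no engine in `d = 3` (see the line's notes); nothing here asserts G. No Theses statement is touched;
no definitions.
-/

noncomputable section

open MeasureTheory Finset Filter
open Literature.Probability.Percolation Literature.Probability.LatticeModels
open Summit.CriticalPhenomena.PercolationContinuityZ3.Theorems.TallClusterMassBound.Negative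
open Summit.CriticalPhenomena.PercolationContinuityZ3.Theorems.TallClusterMassBound.TightnessLine
open Summit.CriticalPhenomena.PercolationContinuityZ3.Theorems.FloorRusso.DilutionToolkit (floorDilutedParam_shift)

namespace Summit.CriticalPhenomena.PercolationContinuityZ3.Theorems.TallClusterMassBound.OnesidedHalves

/-! ## §1 Transport of cluster traces under a relabelling of the vertices -/

section Relabel

variable {V W : Type*}

/-- `|K_{e v} ∩ e(Λ)|(e·ω) = |K_v ∩ Λ|(ω)`. [folklore] -/
theorem clusterCapIn_image_relabel [DecidableEq W] (e : V ≃ W) (Λ : Finset V) (ω : BondConfig V) (v : V) :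
    clusterCapIn (Λ.image e) (BondConfig.relabel (sym2Equiv e) ω) (e v) = clusterCapIn Λ ω v := by
  classical
  rw [clusterCapIn_eq, clusterCapIn_eq, Finset.filter_image, Finset.card_image_of_injective _ e.injective]
  congr 1
  ext z
  simp only [Finset.mem_filter, reachable_relabel_iff]

/-- `|K_max(e(Λ))|(e·ω) = |K_max(Λ)|(ω)`. [folklore] -/
theorem clusterMaxIn_image_relabel [DecidableEq W] (e : V ≃ W) (Λ : Finset V) (ω : BondConfig V) :
    clusterMaxIn (Λ.image e) (BondConfig.relabel (sym2Equiv e) ω) = clusterMaxIn Λ ω := by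
  show (Λ.image e).sup (fun w => clusterCapIn (Λ.image e) (BondConfig.relabel (sym2Equiv e) ω) w) =
    Λ.sup fun v => clusterCapIn Λ ω v
  rw [Finset.sup_image]
  exact Finset.sup_congr rfl fun v _ => clusterCapIn_image_relabel e Λ ω v

end Relabel

/-! ## §2 Lateral shifts preserve the measure -/

/-- **Lateral translation invariance of `P^ℍ_{p,s}`**: `(P^ℍ_{p,s}).map (ω ↦ ω + z) = P^ℍ_{p,s}` for `z₀ = 0`
(a product measure is invariant under a weight-preserving reindexing, `prodBernoulli_map_image_equiv`). [folklore] -/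
theorem floorDilutedPercolation_map_relabel_lateral (p s : unitInterval) {z : V3} (hz : z 0 = 0) :
    (floorDilutedPercolation 3 p s).map (BondConfig.relabel (sym2Equiv (Site.shift z))) =
      floorDilutedPercolation 3 p s := by
  have hfun : (BondConfig.relabel (sym2Equiv (Site.shift z)) : BondConfig V3 → BondConfig V3) =
      fun ω => (sym2Equiv (Site.shift z)) '' ω := funext fun ω => BondConfig.relabel_apply _ ω
  rw [floorDilutedPercolation, hfun]
  exact prodBernoulli_map_image_equiv _ _ (floorDilutedParam_shift p s z hz)

/-- `P^ℍ_{p,s}{ω | ω + z ∈ A} = P^ℍ_{p,s}(A)` for measurable `A` and lateral `z`. [folklore] -/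
theorem floorDilutedPercolation_real_preimage_lateral (p s : unitInterval) {z : V3} (hz : z 0 = 0)
    {A : Set (BondConfig V3)} (hA : MeasurableSet A) :
    (floorDilutedPercolation 3 p s).real (BondConfig.relabel (sym2Equiv (Site.shift z)) ⁻¹' A) =
      (floorDilutedPercolation 3 p s).real A := by
  rw [measureReal_def, measureReal_def, ← Measure.map_apply (MeasurableEquiv.measurable _) hA,
    floorDilutedPercolation_map_relabel_lateral p s hz]

/-! ## §3 The largest cluster trace and the typical maximum of a lateral translate -/

/-- **`P^ℍ(|K_max(Λ + z)| ≥ n) = P^ℍ(|K_max(Λ)| ≥ n)`** for a lateral shift `z` (`z₀ = 0`). [folklore] -/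
theorem real_clusterMaxIn_translate_ge (p s : unitInterval) {z : V3} (hz : z 0 = 0) (Λ : Finset V3) (n : ℕ) :
    (floorDilutedPercolation 3 p s).real {ω | n ≤ clusterMaxIn (Λ.image (· + z)) ω} =
      (floorDilutedPercolation 3 p s).real {ω | n ≤ clusterMaxIn Λ ω} := by
  have himg : Λ.image (· + z) = Λ.image (Site.shift z) := rfl
  have hset : BondConfig.relabel (sym2Equiv (Site.shift z)) ⁻¹' {ω | n ≤ clusterMaxIn (Λ.image (Site.shift z)) ω} =
      {ω | n ≤ clusterMaxIn Λ ω} := by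
    ext ω
    simp only [Set.mem_preimage, Set.mem_setOf_eq, clusterMaxIn_image_relabel]
  rw [himg, ← hset, floorDilutedPercolation_real_preimage_lateral p s hz (measurableSet_clusterMaxIn_ge _ n)]

/-- **Hutchcroft's typical maximum of a lateral translate** (registered helper): `M(Λ + z) = M(Λ)` under every
`P^ℍ_{p,s}`, for `z₀ = 0`. [folklore] -/
theorem typicalMax_translate_lateral : ∀ (p s : unitInterval) {z : V3}, z 0 = 0 → ∀ Λ : Finset V3, typicalMax (floorDilutedPercolation 3 p s) (Λ.image (· + z)) = typicalMax (floorDilutedPercolation 3 p s) Λ := by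
  intro p s z hz Λ
  unfold typicalMax
  congr 1
  ext n
  simp only [Set.mem_setOf_eq, real_clusterMaxIn_translate_ge p s hz]

/-- **Each lateral translate carries a near-typical cluster**: for `z₀ = 0`, nonempty `Λ` and `ε > 0`,
`P^ℍ_{p,s}(|K_max(Λ + z)| < ε M(Λ)) ≤ 8ε` (two-sided universal tightness, `prodBernoulli_real_clusterMaxIn_lt_le`,
at the translate, whose typical maximum is `M(Λ)`). [folklore] -/
theorem real_clusterMaxIn_translate_lt_le (p s : unitInterval) {z : V3} (hz : z 0 = 0) {Λ : Finset V3}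
    (hΛ : Λ.Nonempty) {ε : ℝ} (hε : 0 < ε) :
    (floorDilutedPercolation 3 p s).real
        {ω | (clusterMaxIn (Λ.image (· + z)) ω : ℝ) < ε * typicalMax (floorDilutedPercolation 3 p s) Λ} ≤ 8 * ε := by
  rw [← typicalMax_translate_lateral p s hz Λ]
  exact prodBernoulli_real_clusterMaxIn_lt_le (floorDilutedParam 3 p s) (hΛ.image _) hε

/-- In particular for the half-boxes of the line at `p_c(ℤ³)`: every lateral translate `Λ_r + z` of `Λ_r = halfBox r`
carries an open cluster with at least `ε M(Λ_r)` vertices, with `P^ℍ_{p_c}`-probability `≥ 1 - 8ε`. [folklore] -/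
theorem real_clusterMaxIn_halfBox_translate_lt_le {z : V3} (hz : z 0 = 0) (r : ℕ) {ε : ℝ} (hε : 0 < ε) :
    (floorDilutedPercolation 3 (criticalProbI 3) 1).real
        {ω | (clusterMaxIn ((halfBox r).image (· + z)) ω : ℝ) <
          ε * typicalMax (floorDilutedPercolation 3 (criticalProbI 3) 1) (halfBox r)} ≤ 8 * ε :=
  real_clusterMaxIn_translate_lt_le (criticalProbI 3) 1 hz (halfBox_nonempty r) hε

end Summit.CriticalPhenomena.PercolationContinuityZ3.Theorems.TallClusterMassBound.OnesidedHalves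

end
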